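import Literature.AnabelianGeometry.SemiGraphs.TemperedPiFibreMap
import Literature.AnabelianGeometry.SemiGraphs.TemperedPiSystemSurj
import Literature.AnabelianGeometry.SemiGraphs.UniversalCoveringOverHomogeneous

/-!
# Towards the fullness of the fibre functor ([SemiAnbd] Prop. 3.6 (ii), p. 38): fibres of `liftAt`

Sequel to `TemperedPiFibreMap.lean`.  For the universal morphisms
`liftι_t := liftAt_t ≫ ι : 𝒢_{∞,n} ⟶ T` we determine when two points of a fibre of `𝒢_{∞,n}` have
the same image: `liftι_t (σ u) = liftι_t u ↔ σ⁻¹ · t = t` (rigidity + the translation formula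
`σ ≫ liftι_t = liftι_{σ⁻¹ · t}`), and deduce that a `π₁^temp(𝒢)`-equivariant map
`m : T_{v₀} → T'_{v₀}` satisfies: `liftι_t u₁ = liftι_t u₂ ⇒ liftι_{m t} u₁ = liftι_{m t} u₂`
(stabilisers grow along equivariant maps; `ρ_n` is surjective).  This is the key step in showing
that every morphism `Φ(T) ⟶ Φ(T')` of `B^temp(π₁^temp(𝒢))` comes from a morphism `T ⟶ T'`.
-/

namespace Literature.AnabelianGeometry.SemiGraphs

namespace ProfiniteSemiGraph

open CategoryTheory

universe u

variable {𝒢 : ProfiniteSemiGraph.{u}}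

namespace GaloisLevelData

variable (D : GaloisLevelData 𝒢) (h𝒢 : 𝒢.IsCountable) (T : CovObj 𝒢) (t : (T.SV D.v₀).obj.V) (n : ℕ)
  (hs : (D.S n).Splits (T.component (Sum.inl ⟨D.v₀, t⟩)))

/-- `liftι_t := liftAt_t ≫ ι : 𝒢_{∞,n} ⟶ T`. [cite: MochizukiSemiAnbd2006, Prop 3.6(ii) p.38] -/
noncomputable def liftι : D.cover h𝒢 n ⟶ T :=
  D.liftAt h𝒢 T t n hs ≫ T.componentι (Sum.inl ⟨D.v₀, t⟩)

/-- `liftι_t (bp) = t`. [cite: MochizukiSemiAnbd2006, Prop 3.6(ii) p.38] -/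
theorem liftι_bp : ((D.liftι h𝒢 T t n hs).fV D.v₀).hom.hom (D.bp n) = t := by
  change (((D.liftAt h𝒢 T t n hs).fV D.v₀).hom.hom (D.bp n)).1 = t
  rw [D.liftAt_bp]

/-- `liftι_t (σ⁻¹ bp) = σ · t`. [cite: MochizukiSemiAnbd2006, Prop 3.6(ii) p.38] -/
theorem liftι_inv_bp (σ : D.Gal h𝒢 n) :
    ((D.liftι h𝒢 T t n hs).fV D.v₀).hom.hom (((σ⁻¹ : D.Gal h𝒢 n).hom.fV D.v₀).hom.hom (D.bp n)) =
      D.actAt h𝒢 T t n hs σ := rfl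

/-- Translation formula: `σ ≫ liftι_t = liftι_{σ⁻¹ · t}`. [cite: MochizukiSemiAnbd2006, Prop 3.6(ii) p.38] -/
theorem aut_comp_liftι (σ : D.Gal h𝒢 n) :
    σ.hom ≫ D.liftι h𝒢 T t n hs =
      D.liftι h𝒢 T (D.actAt h𝒢 T t n hs σ⁻¹) n (D.splits_actAt h𝒢 T t n hs σ⁻¹) := by
  unfold liftι
  rw [D.liftAt_actAt h𝒢 T t n hs σ⁻¹, inv_inv, Category.assoc, Category.assoc,
    CovObj.componentIso_hom_ι]

/-- Rigidity for `liftι`: determined by the value at any one point. [cite: MochizukiSemiAnbd2006, Prop 3.6(ii) p.38] -/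
theorem liftι_eq_of_apply_eq {t t' : (T.SV D.v₀).obj.V}
    (hs : (D.S n).Splits (T.component (Sum.inl ⟨D.v₀, t⟩)))
    (hs' : (D.S n).Splits (T.component (Sum.inl ⟨D.v₀, t'⟩))) {v : 𝒢.graph.Vertex}
    (u : (D.S n).FibV (Sum.inl (D.W n)) v)
    (h : ((D.liftι h𝒢 T t n hs).fV v).hom.hom u = ((D.liftι h𝒢 T t' n hs').fV v).hom.hom u) :
    t = t' := by
  have e := (D.S n).univCoverOver_hom_ext _ h𝒢 (D.liftι h𝒢 T t n hs) (D.liftι h𝒢 T t' n hs') u h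
  have h1 := D.liftι_bp h𝒢 T t n hs
  rw [e, D.liftι_bp] at h1
  exact h1.symm

/-- **Fibres of `liftι_t`**: `liftι_t (σ u) = liftι_t u ↔ σ⁻¹ · t = t`.
[cite: MochizukiSemiAnbd2006, Prop 3.6(ii) p.38] -/
theorem liftι_aut_apply_eq_iff (σ : D.Gal h𝒢 n) {v : 𝒢.graph.Vertex}
    (u : (D.S n).FibV (Sum.inl (D.W n)) v) :
    ((D.liftι h𝒢 T t n hs).fV v).hom.hom ((σ.hom.fV v).hom.hom u) =
      ((D.liftι h𝒢 T t n hs).fV v).hom.hom u ↔ D.actAt h𝒢 T t n hs σ⁻¹ = t := by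
  have key : ((D.liftι h𝒢 T t n hs).fV v).hom.hom ((σ.hom.fV v).hom.hom u) =
      ((D.liftι h𝒢 T (D.actAt h𝒢 T t n hs σ⁻¹) n (D.splits_actAt h𝒢 T t n hs σ⁻¹)).fV v).hom.hom u := by
    change ((σ.hom ≫ D.liftι h𝒢 T t n hs).fV v).hom.hom u = _
    rw [D.aut_comp_liftι]
  rw [key]
  constructor
  · intro h
    exact D.liftι_eq_of_apply_eq h𝒢 T n _ _ u h
  · intro h
    exact congrArg (fun z => ((z.2.fV v).hom.hom u : (T.SV v).obj.V))
      (show (⟨D.actAt h𝒢 T t n hs σ⁻¹, D.liftι h𝒢 T _ n (D.splits_actAt h𝒢 T t n hs σ⁻¹)⟩ :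
        Σ' s : (T.SV D.v₀).obj.V, D.cover h𝒢 n ⟶ T) = ⟨t, D.liftι h𝒢 T t n hs⟩ from by
        have : ∀ (s s' : (T.SV D.v₀).obj.V) (e : s = s')
            (hS : (D.S n).Splits (T.component (Sum.inl ⟨D.v₀, s⟩)))
            (hS' : (D.S n).Splits (T.component (Sum.inl ⟨D.v₀, s'⟩))),
            (⟨s, D.liftι h𝒢 T s n hS⟩ : Σ' s : (T.SV D.v₀).obj.V, D.cover h𝒢 n ⟶ T) =
              ⟨s', D.liftι h𝒢 T s' n hS'⟩ := by
          intro s s' e hS hS'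
          subst e
          rfl
        exact this _ _ h _ _)

section Equivariant

variable (T' : CovObj 𝒢) (lev : (T.SV D.v₀).obj.V → ℕ)
  (hlev : ∀ (t : (T.SV D.v₀).obj.V) (n : ℕ), lev t ≤ n →
    (D.S n).Splits (T.component (Sum.inl ⟨D.v₀, t⟩)))
  (lev' : (T'.SV D.v₀).obj.V → ℕ)
  (hlev' : ∀ (t : (T'.SV D.v₀).obj.V) (n : ℕ), lev' t ≤ n →
    (D.S n).Splits (T'.component (Sum.inl ⟨D.v₀, t⟩)))
  (m : D.fibreObj h𝒢 T lev hlev ⟶ D.fibreObj h𝒢 T' lev' hlev')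

/-- Stabilisers grow along `π₁^temp`-equivariant maps: if `σ · t = t` then `σ · m t = m t`
(levels `n ≥ lev t, lev' (m t)`; uses the surjectivity of `ρ_n`).
[cite: MochizukiSemiAnbd2006, Prop 3.6(ii) p.38] -/
theorem actAt_map_eq_self (hn : lev t ≤ n) (hn' : lev' (m.hom.hom t) ≤ n) (σ : D.Gal h𝒢 n)
    (hσ : D.actAt h𝒢 T t n (hlev t n hn) σ = t) :
    D.actAt h𝒢 T' (m.hom.hom t) n (hlev' _ n hn') σ = m.hom.hom t := by
  obtain ⟨γ, rfl⟩ := D.proj_surjective h𝒢 n σ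
  rw [D.actAt_proj_eq h𝒢 T' lev' hlev' _ γ n hn']
  rw [D.actAt_proj_eq h𝒢 T lev hlev t γ n hn] at hσ
  -- equivariance of `m`: `m (γ · t) = γ · m t`
  have hm := ConcreteCategory.congr_hom (m.hom.comm γ) t
  change m.hom.hom (D.piAct h𝒢 T lev hlev γ t) = D.piAct h𝒢 T' lev' hlev' γ (m.hom.hom t) at hm
  change D.piAct h𝒢 T lev hlev γ t = t at hσ
  change D.piAct h𝒢 T' lev' hlev' γ (m.hom.hom t) = m.hom.hom t
  rw [← hm, hσ]

/-- **Key step of fullness** (vertex fibres): if two points of a fibre of `𝒢_{∞,n}` have the same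
image under `liftι_t`, they have the same image under `liftι_{m t}`.
[cite: MochizukiSemiAnbd2006, Prop 3.6(ii) p.38] -/
theorem liftι_map_eq_of_liftι_eq (hn : lev t ≤ n) (hn' : lev' (m.hom.hom t) ≤ n)
    {v : 𝒢.graph.Vertex} (u₁ u₂ : (D.S n).FibV (Sum.inl (D.W n)) v)
    (h : ((D.liftι h𝒢 T t n (hlev t n hn)).fV v).hom.hom u₁ =
      ((D.liftι h𝒢 T t n (hlev t n hn)).fV v).hom.hom u₂) :
    ((D.liftι h𝒢 T' (m.hom.hom t) n (hlev' _ n hn')).fV v).hom.hom u₁ =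
      ((D.liftι h𝒢 T' (m.hom.hom t) n (hlev' _ n hn')).fV v).hom.hom u₂ := by
  obtain ⟨η, hη⟩ := (D.S n).exists_aut_apply_eq' h𝒢 (D.W n) (D.htrans n) u₁ u₂
  let σ : D.Gal h𝒢 n := η
  have hη' : (σ.hom.fV v).hom.hom u₁ = u₂ := hη
  rw [← hη'] at h ⊢
  have h3 := (D.liftι_aut_apply_eq_iff h𝒢 T t n (hlev t n hn) σ u₁).mp h.symm
  have h4 := D.actAt_map_eq_self h𝒢 T t n T' lev hlev lev' hlev' m hn hn' σ⁻¹ h3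
  exact ((D.liftι_aut_apply_eq_iff h𝒢 T' (m.hom.hom t) n (hlev' _ n hn') σ u₁).mpr h4).symm

end Equivariant

end GaloisLevelData

end ProfiniteSemiGraph

end Literature.AnabelianGeometry.SemiGraphs
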